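import Literature.MathematicalPhysics.QuantumManyBody.PeriodicBoseGasCouplingPath
import Literature.MathematicalPhysics.QuantumManyBody.WeightedCorrector
import HarnessLib

/-!
# The insertion state `φ₀ ⊗ Θ`: decoupled energy and zero-momentum overlap

Topic `Literature/MathematicalPhysics/QuantumManyBody` (companion of `PeriodicBoseGasCouplingPath.lean`;
helper for the registered stub `stub_insertionStateIdentities` of crux `CorrectorClosure`,
stmt-AtomisticToContinuum-12058, line `llp-fidelity-arc`). Two bookkeeping identities for the
insertion state `insertionState hL Θ = φ₀ ⊗ Θ : (x₀, Y) ↦ L^{-3/2} Θ(Y)` of a periodic `N`-boson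
state `Θ` on the torus of side `L > 0`:

* `coupledEnergy_zero_insertionState` : at zero impurity–bath coupling the energy of `φ₀ ⊗ Θ` is
  the bath energy, `⟨φ₀ ⊗ Θ, H₀ (φ₀ ⊗ Θ)⟩ = periodicEnergy v Θ` (`∇φ₀ = 0`, `∫_cell |φ₀|² = 1`,
  Tonelli with the tagged coordinate outermost);
* `taggedInner_insertionState` and `nnnorm_taggedInner_insertionState_sq` : the overlap with an
  `(N+1)`-body state `Ψ` is `⟨φ₀ ⊗ Θ, Ψ⟩ = L^{-3/2} ∫_{cell^N} conj Θ(Y) (∫_cell Ψ(x, Y) dx) dY`,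
  whence `|⟨φ₀ ⊗ Θ, Ψ⟩|² = L⁻³ |∫_{cell^N} conj Θ(Y) ∫_cell Ψ(x, Y) dx dY|²` — the insertion
  (quasiparticle) residue at zero momentum [GuentherEtAl2021, eq. (3)] in the form in which the
  route item `InsertionResidue` states it.

The only analysis is Fubini on `cell^{N+1} ≅ cell × cell^N` for the Bochner integral of a
continuous integrand (`setIntegral_cellN_succ_right_of_continuous`), transported along the
measure-preserving splitting map `(x, Y) ↦ vecCons x Y` of `SwapPurity.lean`
(`measurePreserving_vecCons`); Mathlib supplies `MeasurePreserving.setIntegral_preimage_emb`,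
`Measure.prod_restrict` and `integral_prod_symm`.

## References

* [GuentherEtAl2021] N.-E. Guenther, R. Schmidt, G. M. Bruun, V. Gurarie, P. Massignan, *Mobile
  impurity in a Bose–Einstein condensate and the orthogonality catastrophe*, Phys. Rev. A 103 (2021)
  013317: eq. (3) (the quasiparticle residue `Z = |⟨Ψ, φ₀ ⊗ Θ⟩|²`).
-/

noncomputable section

open MeasureTheory
open scoped ENNReal NNReal ComplexConjugate

namespace Literature.MathematicalPhysics.QuantumManyBody.BoseGas

variable {N : ℕ} {L : ℝ}

/-! ## Fubini on the cell for continuous integrands -/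

/-- The splitting map pulls the `(N+1)`-particle cell back to the product of cells:
`vecCons ⁻¹' [0,L)^{3(N+1)} = [0,L)³ × [0,L)^{3N}`. [folklore] -/
theorem vecCons_preimage_cellN :
    (fun p : Space × Config N => (Matrix.vecCons p.1 p.2 : Config (N + 1))) ⁻¹' cellN (N + 1) L =
      cell L ×ˢ cellN N L := by
  ext p
  exact vecCons_mem_cellN_succ_iff

/-- `(x, Y) ↦ vecCons x Y : ℝ³ × (ℝ³)^N → (ℝ³)^{N+1}` is a measurable embedding (it is the inverse of
the measurable equivalence `piFinSuccAbove` at the coordinate `0`). [folklore] -/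
theorem measurableEmbedding_vecCons :
    MeasurableEmbedding fun p : Space × Config N => (Matrix.vecCons p.1 p.2 : Config (N + 1)) := by
  have hfun : (fun p : Space × Config N => (Matrix.vecCons p.1 p.2 : Config (N + 1))) =
      ⇑(MeasurableEquiv.piFinSuccAbove (fun _ : Fin (N + 1) => Space) 0).symm :=
    funext fun p => (piFinSuccAbove_symm_apply_eq_vecCons p).symm
  rw [hfun]
  exact (MeasurableEquiv.piFinSuccAbove (fun _ : Fin (N + 1) => Space) 0).symm.measurableEmbedding

/-- A continuous integrand on `(ℝ³)^{N+1}`, read on `ℝ³ × (ℝ³)^N`, is integrable for the product of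
the two cell-restricted Lebesgue measures. [folklore] -/
theorem integrable_comp_vecCons_prod_restrict {E : Type*} [NormedAddCommGroup E]
    {F : Config (N + 1) → E} (hF : Continuous F) :
    Integrable (fun p : Space × Config N => F (Matrix.vecCons p.1 p.2))
      ((volume.restrict (cell L)).prod (volume.restrict (cellN N L))) := by
  have h := ((measurePreserving_vecCons (n := N)).integrableOn_comp_preimage
    measurableEmbedding_vecCons (f := F) (s := cellN (N + 1) L)).2 (integrableOn_cellN hF L)
  rw [vecCons_preimage_cellN] at h
  rw [Measure.prod_restrict]
  exact h

/-- **Fubini on the cell for the Bochner integral, tagged coordinate innermost**: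
`∫_{[0,L)^{3(N+1)}} F = ∫_{[0,L)^{3N}} (∫_{[0,L)³} F(x₀, Y) dx₀) dY` for `F` continuous on
`(ℝ³)^{N+1}` (values in a real Banach space, e.g. `ℂ`). [folklore] -/
theorem setIntegral_cellN_succ_right_of_continuous {E : Type*} [NormedAddCommGroup E]
    [NormedSpace ℝ E] {F : Config (N + 1) → E} (hF : Continuous F) :
    ∫ X in cellN (N + 1) L, F X = ∫ Y in cellN N L, ∫ x in cell L, F (Matrix.vecCons x Y) :=
  calc ∫ X in cellN (N + 1) L, F X
      = ∫ p in (fun p : Space × Config N => (Matrix.vecCons p.1 p.2 : Config (N + 1))) ⁻¹'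
            cellN (N + 1) L, F (Matrix.vecCons p.1 p.2) ∂(volume.prod volume) :=
        ((measurePreserving_vecCons (n := N)).setIntegral_preimage_emb
          measurableEmbedding_vecCons F _).symm
    _ = ∫ p, F (Matrix.vecCons p.1 p.2)
          ∂((volume.restrict (cell L)).prod (volume.restrict (cellN N L))) := by
        rw [vecCons_preimage_cellN, Measure.prod_restrict]
    _ = ∫ Y in cellN N L, ∫ x in cell L, F (Matrix.vecCons x Y) :=
        integral_prod_symm (fun p : Space × Config N => F (Matrix.vecCons p.1 p.2))
          (integrable_comp_vecCons_prod_restrict hF)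

/-- **Fubini on the cell for the Bochner integral, tagged coordinate outermost**:
`∫_{[0,L)^{3(N+1)}} F = ∫_{[0,L)³} (∫_{[0,L)^{3N}} F(x₀, Y) dY) dx₀` for `F` continuous on
`(ℝ³)^{N+1}`. [folklore] -/
theorem setIntegral_cellN_succ_left_of_continuous {E : Type*} [NormedAddCommGroup E]
    [NormedSpace ℝ E] {F : Config (N + 1) → E} (hF : Continuous F) :
    ∫ X in cellN (N + 1) L, F X = ∫ x in cell L, ∫ Y in cellN N L, F (Matrix.vecCons x Y) :=
  calc ∫ X in cellN (N + 1) L, F X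
      = ∫ p in (fun p : Space × Config N => (Matrix.vecCons p.1 p.2 : Config (N + 1))) ⁻¹'
            cellN (N + 1) L, F (Matrix.vecCons p.1 p.2) ∂(volume.prod volume) :=
        ((measurePreserving_vecCons (n := N)).setIntegral_preimage_emb
          measurableEmbedding_vecCons F _).symm
    _ = ∫ p, F (Matrix.vecCons p.1 p.2)
          ∂((volume.restrict (cell L)).prod (volume.restrict (cellN N L))) := by
        rw [vecCons_preimage_cellN, Measure.prod_restrict]
    _ = ∫ x in cell L, ∫ Y in cellN N L, F (Matrix.vecCons x Y) :=
        integral_prod (fun p : Space × Config N => F (Matrix.vecCons p.1 p.2))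
          (integrable_comp_vecCons_prod_restrict hF)

/-! ## The zero-momentum overlap of the insertion state -/

/-- **The overlap of the insertion state with an `(N+1)`-body state**:
`⟨φ₀ ⊗ Θ, Ψ⟩ = L^{-3/2} ∫_{[0,L)^{3N}} conj Θ(Y) (∫_{[0,L)³} Ψ(x₀, Y) dx₀) dY` (Fubini, the
constant mode pulled out). [cite: GuentherEtAl2021, eq. (3)] -/
theorem taggedInner_insertionState (hL : 0 < L) (Θ : PeriodicTrialState N L)
    (Ψ : PeriodicTrialState (N + 1) L) :
    taggedInner (insertionState hL Θ) Ψ.toTagged = ((Real.sqrt (L ^ 3))⁻¹ : ℂ) *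
      ∫ Y in cellN N L, conj (Θ.ψ Y) * ∫ x in cell L, Ψ.ψ (Matrix.vecCons x Y) := by
  have hcont : Continuous fun X : Config (N + 1) =>
      conj ((insertionState hL Θ).ψ X) * Ψ.toTagged.ψ X :=
    (Complex.continuous_conj.comp (insertionState hL Θ).contDiff.continuous).mul
      Ψ.contDiff.continuous
  rw [taggedInner, setIntegral_cellN_succ_right_of_continuous hcont, ← integral_const_mul]
  refine integral_congr_ae (Filter.Eventually.of_forall fun Y => ?_)
  simp only [insertionState_ψ, PeriodicTrialState.toTagged_ψ, Matrix.tail_cons, map_mul,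
    map_inv₀, Complex.conj_ofReal]
  rw [integral_const_mul, mul_assoc]

/-- **The insertion residue as a squared overlap**: for `Θ` an `N`-body and `Ψ` an `(N+1)`-body
periodic state on the torus of side `L > 0`,
`|⟨φ₀ ⊗ Θ, Ψ⟩|² = L⁻³ |∫_{[0,L)^{3N}} conj Θ(Y) ∫_{[0,L)³} Ψ(x₀, Y) dx₀ dY|²` — the zero-momentum
insertion (quasiparticle) residue. [cite: GuentherEtAl2021, eq. (3)] -/
theorem nnnorm_taggedInner_insertionState_sq (hL : 0 < L) (Θ : PeriodicTrialState N L)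
    (Ψ : PeriodicTrialState (N + 1) L) :
    ((‖taggedInner (insertionState hL Θ) Ψ.toTagged‖₊ : ℝ≥0∞) ^ 2) =
      ENNReal.ofReal ((L ^ 3)⁻¹) *
        (‖∫ X in cellN N L, conj (Θ.ψ X) *
            ∫ x in cell L, Ψ.ψ (Matrix.vecCons x X)‖₊ : ℝ≥0∞) ^ 2 := by
  rw [taggedInner_insertionState, nnnorm_mul, ENNReal.coe_mul, mul_pow, nnnorm_constantMode_sq hL,
    ← ENNReal.ofReal_pow hL.le, ← ENNReal.ofReal_inv_of_pos (pow_pos hL 3)]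

/-! ## The decoupled energy of the insertion state -/

/-- The periodised potential of a measurable profile is measurable. [folklore] -/
private theorem measurable_periodizedPotential_ins {v : ℝ → ℝ≥0∞} (hv : Measurable v) (L : ℝ) :
    Measurable (periodizedPotential v L) := by
  show Measurable fun x => ∑' n : Fin 3 → ℤ, v ‖x - latticeVec L n‖
  exact Measurable.tsum fun n => hv.comp (measurable_id.sub_const _).norm

/-- The periodic pair interaction of a measurable profile is measurable. [folklore] -/
private theorem measurable_periodicInteraction_ins {v : ℝ → ℝ≥0∞} (hv : Measurable v) (L : ℝ)
    {M : ℕ} : Measurable fun X : Config M => periodicInteraction v L X := by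
  unfold periodicInteraction
  refine Finset.measurable_sum _ fun i _ => Finset.measurable_sum _ fun j _ => ?_
  exact (measurable_periodizedPotential_ins hv L).comp
    ((measurable_pi_apply i).sub (measurable_pi_apply j))

/-- A constant one-body mode carries no kinetic energy: `|∇c|² = 0`. [folklore] -/
theorem gradSqC_const (c : ℂ) (x : Space) : gradSqC (fun _ : Space => c) x = 0 := by
  simp [gradSqC]

/-- **Decoupled energy of the insertion state.** At zero impurity–bath coupling the energy of
`φ₀ ⊗ Θ` is the bath energy: `⟨φ₀ ⊗ Θ, H₀ (φ₀ ⊗ Θ)⟩ = periodicEnergy v Θ` (the constant mode has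
`∇φ₀ = 0` and `∫_{[0,L)³} |φ₀|² = 1`; Tonelli with the tagged coordinate outermost). [folklore] -/
theorem coupledEnergy_zero_insertionState {v : ℝ → ℝ≥0∞} (hv : Measurable v) (hL : 0 < L)
    (Θ : PeriodicTrialState N L) :
    coupledEnergy v 0 (insertionState hL Θ) = periodicEnergy v Θ := by
  have hfd : Differentiable ℝ (fun _ : Space => ((Real.sqrt (L ^ 3))⁻¹ : ℂ)) :=
    differentiable_const _
  have hΘd : Differentiable ℝ Θ.ψ := Θ.contDiff.differentiable one_ne_zero
  have hψ : (insertionState hL Θ).ψ =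
      taggedProduct (fun _ : Space => ((Real.sqrt (L ^ 3))⁻¹ : ℂ)) Θ.ψ := rfl
  have hmeas : Measurable fun X : Config (N + 1) =>
      taggedKineticDensity 1 (insertionState hL Θ).ψ X +
        periodicInteraction v L (Matrix.vecTail X) *
          (‖(insertionState hL Θ).ψ X‖₊ : ℝ≥0∞) ^ 2 :=
    (measurable_taggedKineticDensity 1 _).add
      (((measurable_periodicInteraction_ins hv L).comp measurable_vecTail).mul
        (((insertionState hL Θ).contDiff.continuous.measurable.nnnorm.coe_nnreal_ennreal).pow_const
          _))
  rw [coupledEnergy_zero, setLIntegral_cellN_succ_left hmeas]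
  -- the integrand on the slice `(x, Y)`
  have hpt : ∀ (x : Space) (Y : Config N),
      taggedKineticDensity 1 (insertionState hL Θ).ψ (Matrix.vecCons x Y) +
          periodicInteraction v L (Matrix.vecTail (Matrix.vecCons x Y)) *
            (‖(insertionState hL Θ).ψ (Matrix.vecCons x Y)‖₊ : ℝ≥0∞) ^ 2 =
        ((‖((Real.sqrt (L ^ 3))⁻¹ : ℂ)‖₊ : ℝ≥0∞) ^ 2) *
          (kineticDensity Θ.ψ Y + periodicInteraction v L Y * (‖Θ.ψ Y‖₊ : ℝ≥0∞) ^ 2) := by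
    intro x Y
    rw [hψ, taggedKineticDensity_taggedProduct hfd hΘd, taggedProduct_vecCons]
    simp only [Matrix.cons_val_zero, Matrix.tail_cons, gradSqC_const, mul_zero, zero_add,
      nnnorm_mul, ENNReal.coe_mul, mul_pow]
    ring
  simp only [hpt]
  -- the inner integral over the bath is `|c|² ⟨Θ, H Θ⟩`
  have hinner : ∫⁻ Y in cellN N L, ((‖((Real.sqrt (L ^ 3))⁻¹ : ℂ)‖₊ : ℝ≥0∞) ^ 2) *
      (kineticDensity Θ.ψ Y + periodicInteraction v L Y * (‖Θ.ψ Y‖₊ : ℝ≥0∞) ^ 2) =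
        ((‖((Real.sqrt (L ^ 3))⁻¹ : ℂ)‖₊ : ℝ≥0∞) ^ 2) * periodicEnergy v Θ := by
    rw [lintegral_const_mul' _ _ (ENNReal.pow_ne_top ENNReal.coe_ne_top), periodicEnergy]
  rw [hinner, lintegral_mul_const _ measurable_const, lintegral_cell_const_sq hL, one_mul]

end Literature.MathematicalPhysics.QuantumManyBody.BoseGas

end
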